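import Summits.AtomisticToContinuum.BoseEinsteinCondensation.Theses.BECNudgeWalk
import Literature.MathematicalPhysics.QuantumManyBody.CondensateOccupationStability
import Summits.AtomisticToContinuum.BoseEinsteinCondensation.Theorems.BECGroundStateSOSPeriodicIRBoundWFRegularity
import HarnessLib

/-!
# Depletion increment from the condensate variance (Dirichlet box, fixed `N`, `L`)

Crux `BECNudgeWalk.NudgeRemoval` (stmt-AtomisticToContinuum-14361), line `registered`, stub B
`stub_depletionOfVariance`: the kinematic half of one step of the reward walk. For Dirichlet trial
states `Ψ, Ψ'` of `N = n + 1` bosons in `Λ_L`, any `c : ℂ` and reals `V, η ≥ 0`: if the flat-mode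
number operator `n̂₀ = Σ_i P_i` (`P_i` = projection onto `φ₀ = L^{-3/2} 1_Λ` in particle `i`) has
variance `‖n̂₀Ψ‖² − n₀(Ψ)² ≤ V` in `Ψ` and `∫ |Ψ' − cΨ|² ≤ η²`, then
`N − n₀(Ψ') ≤ (N − n₀(Ψ)) + Nη² + 2√V·η` (`n₀ = occupation N (constantMode L)`).

Proof. `n̂₀Ψ = a₀†(a₀Ψ)` pointwise by Bose symmetry (`dv_numberOp_eq`; `a₀ = modeAn L φ₀`,
`a₀† = modeCr φ₀` of `TorusFockLayer.lean`), so adjointness (`integral_conj_modeCr_mul`) gives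
`⟨n̂₀Ψ, Φ⟩ = ⟨a₀Ψ, a₀Φ⟩` for every trial state `Φ`, while `n₀(Φ) = ‖a₀Φ‖²`
(`condensateOccupation_eq_lintegral_modeAn_constantMode`); in the Hilbert spaces `Lp ℂ 2` the
estimate is then inner-product algebra (`dv_abstract`: `z = n̂₀Ψ − n₀(Ψ)Ψ ⊥ Ψ` has `‖z‖² ≤ V`,
`⟨n̂₀Ψ, Ψ'⟩ = ⟨z, Ψ' − cΨ⟩ + n₀(Ψ)⟨Ψ, Ψ'⟩`, Cauchy–Schwarz twice, `|⟨Ψ, Ψ'⟩|² ≥ 1 − η²`).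
-/

noncomputable section

open MeasureTheory Filter
open scoped ENNReal NNReal ComplexConjugate InnerProductSpace

namespace Summit.AtomisticToContinuum.BoseEinsteinCondensation.Cruxes.NudgeRemoval.Registered

open Literature.MathematicalPhysics.QuantumManyBody.BoseGas
open Cruxes.PeriodicIRBound.LinearPhFloorWagner.WF (continuous_modeAn)

/-! ### The Hilbert-space core -/

/-- **The Hilbert-space core of the depletion estimate.** In complex inner product spaces
`E ∋ ψ, ψ', T` and `F ∋ A, A'` with `‖ψ‖ = ‖ψ'‖ = 1`, `⟪T, ψ'⟫ = ⟪A, A'⟫`, `⟪T, ψ⟫ = ‖A‖²`,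
`‖T‖² ≤ ‖A‖⁴ + V` and `‖ψ' − cψ‖ ≤ η`: `‖A‖²(1 − η²) − 2√V η ≤ ‖A'‖²` (read `T = n̂₀Ψ`, `A = a₀Ψ`,
`A' = a₀Ψ'`, `‖A‖² = n₀(Ψ)`, `‖A'‖² = n₀(Ψ')`). [folklore] -/
private theorem dv_abstract {E F : Type*} [NormedAddCommGroup E] [InnerProductSpace ℂ E]
    [NormedAddCommGroup F] [InnerProductSpace ℂ F] (ψ ψ' T : E) (A A' : F) (c : ℂ) {V η : ℝ}
    (hV : 0 ≤ V) (hη : 0 ≤ η) (hψ : ‖ψ‖ = 1) (hψ' : ‖ψ'‖ = 1)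
    (hT' : ⟪T, ψ'⟫_ℂ = ⟪A, A'⟫_ℂ) (hT : ⟪T, ψ⟫_ℂ = ⟪A, A⟫_ℂ)
    (hvar : ‖T‖ ^ 2 ≤ ‖A‖ ^ 2 * ‖A‖ ^ 2 + V) (hdist : ‖ψ' - c • ψ‖ ^ 2 ≤ η ^ 2) :
    ‖A‖ ^ 2 * (1 - η ^ 2) - 2 * Real.sqrt V * η ≤ ‖A'‖ ^ 2 := by
  set m := ‖A‖ ^ 2 with hm
  set m' := ‖A'‖ ^ 2 with hm'
  have hm0 : 0 ≤ m := sq_nonneg _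
  have hTm : ⟪T, ψ⟫_ℂ = (m : ℂ) := by
    rw [hT, inner_self_eq_norm_sq_to_K, hm]; push_cast; rfl
  -- `z = T - m ψ ⊥ ψ`, `‖z‖² = ‖T‖² - m² ≤ V`
  set z := T - (m : ℂ) • ψ with hz
  have hzψ : ⟪z, ψ⟫_ℂ = 0 := by
    rw [hz, inner_sub_left, inner_smul_left, hTm, inner_self_eq_norm_sq_to_K, hψ,
      Complex.conj_ofReal]
    push_cast; ring
  have hz2 : ‖z‖ ^ 2 ≤ V := by
    have h : ‖z‖ ^ 2 = ‖T‖ ^ 2 - m ^ 2 := by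
      rw [hz, @norm_sub_sq ℂ, inner_smul_right, hTm, norm_smul, hψ, mul_one, Complex.norm_real,
        Real.norm_of_nonneg hm0, ← Complex.ofReal_mul, RCLike.re_to_complex, Complex.ofReal_re]
      ring
    rw [h]; nlinarith
  have hzn : ‖z‖ ≤ Real.sqrt V := (Real.le_sqrt (norm_nonneg _) hV).2 hz2
  -- `⟪z, ψ'⟫ = ⟪z, ψ' - cψ⟫` is small
  have hdist' : ‖ψ' - c • ψ‖ ≤ η := (pow_le_pow_iff_left₀ (norm_nonneg _) hη two_ne_zero).1 hdist
  have hzb : ‖⟪z, ψ'⟫_ℂ‖ ≤ Real.sqrt V * η := by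
    have h : ⟪z, ψ'⟫_ℂ = ⟪z, ψ' - c • ψ⟫_ℂ := by
      rw [inner_sub_right, inner_smul_right, hzψ, mul_zero, sub_zero]
    rw [h]
    calc ‖⟪z, ψ' - c • ψ⟫_ℂ‖ ≤ ‖z‖ * ‖ψ' - c • ψ‖ := norm_inner_le_norm _ _
      _ ≤ Real.sqrt V * η := mul_le_mul hzn hdist' (norm_nonneg _) (Real.sqrt_nonneg _)
  -- the overlap `α = ⟪ψ, ψ'⟫`: `|α| ≤ 1`, `|α|² ≥ 1 - η²`
  set α := ⟪ψ, ψ'⟫_ℂ with hα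
  have hα1 : ‖α‖ ≤ 1 := by
    calc ‖α‖ ≤ ‖ψ‖ * ‖ψ'‖ := norm_inner_le_norm _ _
      _ = 1 := by rw [hψ, hψ', mul_one]
  have hα2 : 1 - η ^ 2 ≤ ‖α‖ ^ 2 := by
    have h1 : ‖ψ' - c • ψ‖ ^ 2 = 1 - 2 * RCLike.re (c * conj α) + ‖c‖ ^ 2 := by
      rw [@norm_sub_sq ℂ, inner_smul_right, norm_smul, hψ, hψ', mul_one, one_pow, hα,
        inner_conj_symm]
    have h2 : RCLike.re (c * conj α) ≤ ‖c‖ * ‖α‖ := by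
      calc RCLike.re (c * conj α) ≤ ‖c * conj α‖ := RCLike.re_le_norm _
        _ = ‖c‖ * ‖α‖ := by rw [norm_mul, Complex.norm_conj]
    nlinarith [sq_nonneg (‖c‖ - ‖α‖), norm_nonneg c, norm_nonneg α]
  -- `|⟪A, A'⟫| = |⟪T, ψ'⟫| ≥ m|α| - √V η` and Cauchy–Schwarz `|⟪A, A'⟫|² ≤ m m'`
  have hlow : m * ‖α‖ - Real.sqrt V * η ≤ ‖⟪A, A'⟫_ℂ‖ := by
    have hTψ' : ⟪T, ψ'⟫_ℂ = ⟪z, ψ'⟫_ℂ + (m : ℂ) * α := by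
      rw [hz, inner_sub_left, inner_smul_left, Complex.conj_ofReal]; ring
    have h : ‖(m : ℂ) * α‖ ≤ ‖⟪T, ψ'⟫_ℂ‖ + ‖⟪z, ψ'⟫_ℂ‖ := by
      calc ‖(m : ℂ) * α‖ = ‖⟪T, ψ'⟫_ℂ - ⟪z, ψ'⟫_ℂ‖ := by rw [hTψ', add_sub_cancel_left]
        _ ≤ ‖⟪T, ψ'⟫_ℂ‖ + ‖⟪z, ψ'⟫_ℂ‖ := norm_sub_le _ _
    rw [norm_mul, Complex.norm_real, Real.norm_of_nonneg hm0, hT'] at h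
    linarith
  have hCS : ‖⟪A, A'⟫_ℂ‖ ^ 2 ≤ m * m' := by
    calc ‖⟪A, A'⟫_ℂ‖ ^ 2 ≤ (‖A‖ * ‖A'‖) ^ 2 :=
          pow_le_pow_left₀ (norm_nonneg _) (norm_inner_le_norm _ _) 2
      _ = m * m' := by rw [mul_pow, hm, hm']
  -- conclusion
  set s := Real.sqrt V * η with hs
  have hs0 : 0 ≤ s := mul_nonneg (Real.sqrt_nonneg _) hη
  have h2s : 2 * Real.sqrt V * η = 2 * s := by rw [hs]; ring
  rw [h2s]
  have hαα : m * ‖α‖ ^ 2 ≤ m * ‖α‖ :=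
    mul_le_mul_of_nonneg_left (by nlinarith [norm_nonneg α]) hm0
  have hlow2 : m * (1 - η ^ 2) ≤ m * ‖α‖ ^ 2 := mul_le_mul_of_nonneg_left hα2 hm0
  rcases le_or_gt (m * ‖α‖) s with hcase | hcase
  · nlinarith
  · have hm_pos : 0 < m := by
      rcases hm0.lt_or_eq with h | h
      · exact h
      · rw [← h, zero_mul] at hcase; linarith
    have h1 : (m * ‖α‖ - s) ^ 2 ≤ m * m' :=
      (pow_le_pow_left₀ (by linarith) hlow 2).trans hCS
    have h2 : m * (m * (1 - η ^ 2) - 2 * s) ≤ m * m' := by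
      have e2 : m * ‖α‖ * s ≤ m * s := by
        calc m * ‖α‖ * s ≤ m * 1 * s := by gcongr
          _ = m * s := by ring
      nlinarith [sq_nonneg s]
    exact le_of_mul_le_mul_left h2 hm_pos

/-! ### `L²` bookkeeping: inner products and norms of representatives -/

/-- `⟪f, g⟫ = ∫ conj(f) g` in `L²(μ; ℂ)` for representatives `f`, `g`. [folklore] -/
private theorem dv_inner_toLp {α : Type*} [MeasurableSpace α] {μ : Measure α} {f g : α → ℂ}
    (hf : MemLp f 2 μ) (hg : MemLp g 2 μ) :
    ⟪hf.toLp f, hg.toLp g⟫_ℂ = ∫ x, conj (f x) * g x ∂μ := by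
  rw [L2.inner_def]
  refine integral_congr_ae ?_
  filter_upwards [hf.coeFn_toLp, hg.coeFn_toLp] with x hfx hgx
  rw [hfx, hgx, RCLike.inner_apply']

/-- `‖f‖² = ∫ ‖f‖²` in `L²(μ; ℂ)` for a representative `f`. [folklore] -/
private theorem dv_norm_toLp_sq {α : Type*} [MeasurableSpace α] {μ : Measure α} {f : α → ℂ}
    (hf : MemLp f 2 μ) : ‖hf.toLp f‖ ^ 2 = ∫ x, ‖f x‖ ^ 2 ∂μ := by
  have h : ⟪hf.toLp f, hf.toLp f⟫_ℂ = ((∫ x, ‖f x‖ ^ 2 ∂μ : ℝ) : ℂ) := by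
    rw [dv_inner_toLp hf hf]
    have h2 : (fun x => conj (f x) * f x) = fun x => (((‖f x‖ ^ 2 : ℝ)) : ℂ) := by
      funext x; rw [Complex.conj_mul', Complex.ofReal_pow]
    rw [h2]
    exact integral_ofReal
  rw [inner_self_eq_norm_sq_to_K] at h
  have h' : ((‖hf.toLp f‖ ^ 2 : ℝ) : ℂ) = ((∫ x, ‖f x‖ ^ 2 ∂μ : ℝ) : ℂ) := by
    rw [← h, Complex.ofReal_pow]
    rfl
  exact Complex.ofReal_injective h'

/-- `∫ ‖f‖² = (∫⁻ ‖f‖₊²).toReal` for an a.e. strongly measurable `f`. [folklore] -/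
private theorem dv_integral_norm_sq_eq_toReal {α : Type*} [MeasurableSpace α] {μ : Measure α}
    {f : α → ℂ} (hf : AEStronglyMeasurable f μ) :
    ∫ x, ‖f x‖ ^ 2 ∂μ = (∫⁻ x, ((‖f x‖₊ : ℝ≥0∞)) ^ 2 ∂μ).toReal := by
  rw [integral_eq_lintegral_of_nonneg_ae (Eventually.of_forall fun x => by positivity)
    (hf.norm.aemeasurable.pow_const 2).aestronglyMeasurable]
  simp only [← coe_nnnorm_sq_eq_ofReal]

/-- An a.e. strongly measurable `f` with `∫⁻ ‖f‖₊² < ∞` is in `L²`. [folklore] -/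
private theorem dv_memLp_two_of_lintegral_ne_top {α : Type*} [MeasurableSpace α] {μ : Measure α}
    {f : α → ℂ} (hf : AEStronglyMeasurable f μ) (h : ∫⁻ x, ((‖f x‖₊ : ℝ≥0∞)) ^ 2 ∂μ ≠ ⊤) :
    MemLp f 2 μ := by
  refine ⟨hf, ?_⟩
  rw [eLpNorm_lt_top_iff_lintegral_rpow_enorm_lt_top two_ne_zero ENNReal.ofNat_ne_top]
  simp only [ENNReal.toReal_ofNat, ENNReal.rpow_two, enorm_eq_nnnorm]
  exact h.lt_top

/-! ### Geometry of the box and the cell -/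

/-- `Λ_L^N ⊆ [0,L)^{3N}`: a configuration outside the cell is outside the open box. [folklore] -/
private theorem dv_not_mem_boxN {N : ℕ} {L : ℝ} {X : Config N} (hX : X ∉ cellN N L) :
    X ∉ boxN N L := fun h => hX fun i k => ⟨(h i k).1.le, (h i k).2⟩

/-- A function vanishing off the bounded cell `[0,L)^{3N}` has compact support. [folklore] -/
private theorem dv_hasCompactSupport {N : ℕ} {L : ℝ} {f : Config N → ℂ}
    (hf : ∀ X, X ∉ cellN N L → f X = 0) : HasCompactSupport f :=
  HasCompactSupport.intro (isBounded_cellN N L).isCompact_closure fun X hX =>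
    hf X fun h => hX (subset_closure h)

/-- For a Dirichlet trial state (its own cell truncation) the flat-mode occupation is the
condensate occupation of the cell. [folklore] -/
private theorem dv_occupation_eq_condensateOccupation {N : ℕ} {L : ℝ} (Φ : TrialState N L) :
    occupation N (constantMode L) Φ.ψ = condensateOccupation N L Φ.ψ := by
  rw [condensateOccupation]
  congr 1
  funext X
  by_cases hX : X ∈ cellN N L
  · rw [Set.indicator_of_mem hX]
  · rw [Set.indicator_of_notMem hX, Φ.eq_zero X (dv_not_mem_boxN hX)]

/-- A Dirichlet trial state is in `L²((ℝ³)^N)`. [folklore] -/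
private theorem dv_memLp_trialState {N : ℕ} {L : ℝ} (Φ : TrialState N L) : MemLp Φ.ψ 2 volume :=
  Φ.contDiff.continuous.memLp_of_hasCompactSupport
    (dv_hasCompactSupport fun X hX => Φ.eq_zero X (dv_not_mem_boxN hX))

/-! ### The flat-mode annihilation `a₀ = a(φ₀)` on Dirichlet trial states -/

/-- On the cell the flat mode is the constant `L^{-3/2}`, so `a(φ₀) = a(L^{-3/2})`. [folklore] -/
private theorem dv_modeAn_constantMode {n : ℕ} (L : ℝ) (Φ : Config (n + 1) → ℂ) :
    modeAn L (constantMode L) Φ = modeAn L (fun _ => ((Real.sqrt (L ^ 3))⁻¹ : ℂ)) Φ := by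
  funext Y
  rw [modeAn_apply, modeAn_apply]
  congr 1
  refine setIntegral_congr_fun (measurableSet_cell L) fun x hx => ?_
  simp only [constantMode, Set.indicator_of_mem hx]

/-- `a₀Φ` is continuous for continuous `Φ`. [folklore] -/
private theorem dv_continuous_modeAn {n : ℕ} (L : ℝ) {Φ : Config (n + 1) → ℂ}
    (hΦ : Continuous Φ) : Continuous (modeAn L (constantMode L) Φ) := by
  rw [dv_modeAn_constantMode]
  exact continuous_modeAn L continuous_const hΦ

/-- `a(φ)Φ` vanishes off `[0,L)^{3n}` when `Φ` vanishes off the box `Λ_L^{n+1}`. [folklore] -/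
private theorem dv_modeAn_eq_zero {n : ℕ} {L : ℝ} (φ : Space → ℂ) {Φ : Config (n + 1) → ℂ}
    (hΦ : ∀ X, X ∉ boxN (n + 1) L → Φ X = 0) (Y : Config n) (hY : Y ∉ cellN n L) :
    modeAn L φ Φ Y = 0 := by
  rw [modeAn_apply]
  have h : ∀ x, Φ (Matrix.vecCons x Y) = 0 := fun x => hΦ _ fun hX => hY fun i k => by
    have h := hX i.succ k
    rw [Matrix.cons_val_succ] at h
    exact ⟨h.1.le, h.2⟩
  simp only [h, mul_zero, integral_zero]

/-- `a₀Φ ∈ L²((ℝ³)^n)` for a Dirichlet trial state `Φ`. [folklore] -/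
private theorem dv_memLp_modeAn {n : ℕ} (L : ℝ) (Φ : TrialState (n + 1) L) :
    MemLp (modeAn L (constantMode L) Φ.ψ) 2 volume :=
  (dv_continuous_modeAn L Φ.contDiff.continuous).memLp_of_hasCompactSupport
    (dv_hasCompactSupport fun Y hY => dv_modeAn_eq_zero _ Φ.eq_zero Y hY)

/-- **`n₀(Φ) = ‖a₀Φ‖²`** for a Dirichlet trial state: the flat-mode occupation is the whole-space
`∫⁻ ‖a₀Φ‖₊²`. [folklore] -/
private theorem dv_occupation_eq {n : ℕ} (L : ℝ) (Φ : TrialState (n + 1) L) :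
    occupation (n + 1) (constantMode L) Φ.ψ =
      ∫⁻ Y, ((‖modeAn L (constantMode L) Φ.ψ Y‖₊ : ℝ≥0∞)) ^ 2 := by
  rw [dv_occupation_eq_condensateOccupation, condensateOccupation_eq_lintegral_modeAn_constantMode]
  exact setLIntegral_eq_of_support_subset fun Y hY => not_not.mp fun hYc =>
    hY (by simp [dv_modeAn_eq_zero _ Φ.eq_zero Y hYc])

/-- `n₀(Φ) ≤ N` for a Dirichlet trial state. [folklore] -/
private theorem dv_occupation_le {n : ℕ} {L : ℝ} (hL : 0 < L) (Φ : TrialState (n + 1) L) :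
    occupation (n + 1) (constantMode L) Φ.ψ ≤ ((n + 1 : ℕ) : ℝ≥0∞) := by
  rw [dv_occupation_eq_condensateOccupation]
  calc condensateOccupation (n + 1) L Φ.ψ
      ≤ ((n + 1 : ℕ) : ℝ≥0∞) * ∫⁻ X in cellN (n + 1) L, ((‖Φ.ψ X‖₊ : ℝ≥0∞)) ^ 2 :=
        condensateOccupation_le_card_mul_lintegral hL Φ.contDiff.continuous
    _ ≤ ((n + 1 : ℕ) : ℝ≥0∞) * ∫⁻ X, ((‖Φ.ψ X‖₊ : ℝ≥0∞)) ^ 2 :=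
        mul_le_mul' le_rfl (setLIntegral_le_lintegral _ _)
    _ = ((n + 1 : ℕ) : ℝ≥0∞) := by rw [Φ.norm_eq, mul_one]

/-! ### `n̂₀ = a₀† a₀` and its matrix elements -/

/-- **`n̂₀Ψ = a₀†a₀Ψ` pointwise** for a Bose-symmetric `Ψ`:
`Σ_i L⁻³ 1_Λ(x_i) ∫_Λ Ψ(X[i ↦ y]) dy = a†(φ₀)(a(φ₀)Ψ)(X)` (term by term:
`φ₀(x_j) ∫ conj φ₀(x) Ψ(x, X̂_j) dx` with `Ψ(x, X̂_j) = Ψ(X[j ↦ x])` by symmetry). [folklore] -/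
private theorem dv_numberOp_eq {n : ℕ} {L : ℝ} (hL : 0 < L) (Ψ : TrialState (n + 1) L)
    (X : Config (n + 1)) :
    ∑ i : Fin (n + 1), (((L ^ 3)⁻¹ : ℝ) : ℂ) * (cell L).indicator (fun _ => (1 : ℂ)) (X i) *
        ∫ y in cell L, Ψ.ψ (Function.update X i y) =
      modeCr (constantMode L) (modeAn L (constantMode L) Ψ.ψ) X := by
  rw [modeCr_apply, Finset.mul_sum]
  refine Finset.sum_congr rfl fun j _ => ?_
  rw [modeAn_apply]
  have hsym : ∀ y, Ψ.ψ (Matrix.vecCons y (j.removeNth X)) = Ψ.ψ (Function.update X j y) := by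
    intro y
    have h := vecCons_self_removeNth_comp_cycleRange j (Function.update X j y)
    rw [Function.update_self, Fin.removeNth_update] at h
    rw [← Ψ.symm j.cycleRange (Matrix.vecCons y (j.removeNth X)), h]
  have hint : ∫ x in cell L, conj (constantMode L x) * Ψ.ψ (Matrix.vecCons x (j.removeNth X)) =
      ((Real.sqrt (L ^ 3) : ℝ) : ℂ)⁻¹ * ∫ y in cell L, Ψ.ψ (Function.update X j y) := by
    rw [← integral_const_mul]
    refine setIntegral_congr_fun (measurableSet_cell L) fun x hx => ?_
    rw [hsym, constantMode, Set.indicator_of_mem hx, map_inv₀, Complex.conj_ofReal]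
  rw [hint]
  have hc := sqrt_cast_ne_zero n
  have hL3 : ((Real.sqrt (L ^ 3) : ℝ) : ℂ)⁻¹ * ((Real.sqrt (L ^ 3) : ℝ) : ℂ)⁻¹ =
      (((L ^ 3)⁻¹ : ℝ) : ℂ) := by
    rw [← mul_inv, ← Complex.ofReal_mul, Real.mul_self_sqrt (by positivity), Complex.ofReal_inv]
  by_cases hX : X j ∈ cell L
  · rw [Set.indicator_of_mem hX, constantMode, Set.indicator_of_mem hX, ← hL3]
    field_simp
  · rw [Set.indicator_of_notMem hX, constantMode, Set.indicator_of_notMem hX]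
    simp

/-- **`⟨n̂₀Ψ, Φ⟩ = ⟨a₀Ψ, a₀Φ⟩`** for Dirichlet trial states (adjointness `integral_conj_modeCr_mul`
on the cell, and all functions vanish off the cell). [folklore] -/
private theorem dv_adjoint {n : ℕ} {L : ℝ} (Ψ Φ : TrialState (n + 1) L) :
    ∫ X, conj (modeCr (constantMode L) (modeAn L (constantMode L) Ψ.ψ) X) * Φ.ψ X =
      ∫ Y, conj (modeAn L (constantMode L) Ψ.ψ Y) * modeAn L (constantMode L) Φ.ψ Y := by
  rw [← setIntegral_eq_integral_of_forall_compl_eq_zero (s := cellN (n + 1) L) fun X hX => by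
      rw [Φ.eq_zero X (dv_not_mem_boxN hX), mul_zero],
    ← setIntegral_eq_integral_of_forall_compl_eq_zero (s := cellN n L) fun Y hY => by
      rw [dv_modeAn_eq_zero _ Φ.eq_zero Y hY, mul_zero]]
  exact integral_conj_modeCr_mul (measurable_constantMode L) (norm_constantMode_le L)
    (dv_continuous_modeAn L Ψ.contDiff.continuous) Φ.contDiff.continuous Φ.symm

/-- `n̂₀Ψ = a₀†a₀Ψ` is a.e. strongly measurable. [folklore] -/
private theorem dv_aestronglyMeasurable_numberOp {n : ℕ} (L : ℝ) (Ψ : TrialState (n + 1) L) :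
    AEStronglyMeasurable (modeCr (constantMode L) (modeAn L (constantMode L) Ψ.ψ)) volume := by
  refine Measurable.aestronglyMeasurable ?_
  change Measurable fun X : Config (n + 1) => ((Real.sqrt (n + 1) : ℝ) : ℂ)⁻¹ *
    ∑ j : Fin (n + 1), constantMode L (X j) * modeAn L (constantMode L) Ψ.ψ (j.removeNth X)
  refine Measurable.const_mul (Finset.measurable_sum _ fun j _ => ?_) _
  exact ((measurable_constantMode L).comp (measurable_pi_apply j)).mul
    ((dv_continuous_modeAn L Ψ.contDiff.continuous).measurable.comp
      (continuous_removeNth j).measurable)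

/-! ### The stub -/

/-- Stub B — **depletion increment from the condensate variance** (fixed `N ≥ 1`, `L > 0`; no
Hamiltonian). For Dirichlet trial states `Ψ, Ψ'`, any `c : ℂ` and reals `V, η ≥ 0`: if
`‖n̂₀Ψ‖² ≤ n₀(Ψ)² + V`, where `(n̂₀Ψ)(X) = Σ_i L⁻³ 1_Λ(x_i) ∫_Λ Ψ(X[i ↦ y]) dy` (`= a₀†a₀Ψ` by Bose
symmetry), and `∫ |Ψ' − cΨ|² ≤ η²`, then `N − n₀(Ψ') ≤ (N − n₀(Ψ)) + Nη² + 2√V·η`.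
Proof route (Hilbert-space algebra in `L²((ℝ³)^N)`): with `m = n₀(Ψ) = ‖a₀Ψ‖²`, `α = ⟨Ψ,Ψ'⟩`,
`z = n̂₀Ψ − mΨ ⊥ Ψ`, `‖z‖² = ‖n̂₀Ψ‖² − m² ≤ V`; `⟨n̂₀Ψ, Ψ'⟩ = ⟨z, Ψ' − cΨ⟩ + mα`, so
`|⟨n̂₀Ψ,Ψ'⟩| ≥ m|α| − √V η`; Cauchy–Schwarz for `a₀`: `|⟨n̂₀Ψ,Ψ'⟩|² = |⟨a₀Ψ,a₀Ψ'⟩|² ≤ m·n₀(Ψ')`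
(adjointness `integral_conj_modeCr_mul`, `condensateOccupation_eq_lintegral_modeAn_constantMode`);
`|α|² ≥ 1 − η²`; hence `n₀(Ψ') ≥ m(1 − η²) − 2√V η`. [folklore] -/
theorem stub_depletionOfVariance : ∀ (N : ℕ) (L : ℝ), 0 < N → 0 < L →
    ∀ (Ψ Ψ' : TrialState N L) (c : ℂ) (V η : ℝ), 0 ≤ V → 0 ≤ η →
    (∫⁻ X, (‖∑ i : Fin N, (((L ^ 3)⁻¹ : ℝ) : ℂ) *
        (cell L).indicator (fun _ => (1 : ℂ)) (X i) *
        ∫ y in cell L, Ψ.ψ (Function.update X i y)‖₊ : ℝ≥0∞) ^ 2) ≤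
      occupation N (constantMode L) Ψ.ψ ^ 2 + ENNReal.ofReal V →
    (∫ X, ‖Ψ'.ψ X - c * Ψ.ψ X‖ ^ 2) ≤ η ^ 2 →
    (N : ℝ≥0∞) - occupation N (constantMode L) Ψ'.ψ ≤
      ((N : ℝ≥0∞) - occupation N (constantMode L) Ψ.ψ) +
        ENNReal.ofReal (N * η ^ 2 + 2 * Real.sqrt V * η) := by
  intro N L hN hL
  obtain ⟨n, rfl⟩ : ∃ n, N = n + 1 := ⟨N - 1, by omega⟩
  intro Ψ Ψ' c V η hV hη hvar hdist
  -- `n̂₀Ψ = a₀†a₀Ψ`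
  have hT : ∀ X : Config (n + 1), ∑ i : Fin (n + 1), (((L ^ 3)⁻¹ : ℝ) : ℂ) *
      (cell L).indicator (fun _ => (1 : ℂ)) (X i) * ∫ y in cell L, Ψ.ψ (Function.update X i y) =
      modeCr (constantMode L) (modeAn L (constantMode L) Ψ.ψ) X := dv_numberOp_eq hL Ψ
  simp only [hT] at hvar
  -- finiteness of the occupations
  have hoN := dv_occupation_le hL Ψ
  have hoN' := dv_occupation_le hL Ψ'
  have ho_top := ne_top_of_le_ne_top (ENNReal.natCast_ne_top _) hoN
  have ho_top' := ne_top_of_le_ne_top (ENNReal.natCast_ne_top _) hoN'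
  have hfin : occupation (n + 1) (constantMode L) Ψ.ψ ^ 2 + ENNReal.ofReal V ≠ ⊤ :=
    ENNReal.add_ne_top.2 ⟨ENNReal.pow_ne_top ho_top, ENNReal.ofReal_ne_top⟩
  -- the five `L²` vectors
  have hΨm := dv_memLp_trialState Ψ
  have hΨ'm := dv_memLp_trialState Ψ'
  have hAm := dv_memLp_modeAn L Ψ
  have hA'm := dv_memLp_modeAn L Ψ'
  have hTae := dv_aestronglyMeasurable_numberOp L Ψ
  have hTm := dv_memLp_two_of_lintegral_ne_top hTae (ne_top_of_le_ne_top hfin hvar)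
  -- the hypotheses of the Hilbert-space core
  have hψ1 : ‖hΨm.toLp Ψ.ψ‖ = 1 := by
    have h := dv_norm_toLp_sq hΨm
    rw [dv_integral_norm_sq_eq_toReal hΨm.1, Ψ.norm_eq, ENNReal.toReal_one] at h
    exact (pow_eq_one_iff_of_nonneg (norm_nonneg _) two_ne_zero).1 h
  have hψ'1 : ‖hΨ'm.toLp Ψ'.ψ‖ = 1 := by
    have h := dv_norm_toLp_sq hΨ'm
    rw [dv_integral_norm_sq_eq_toReal hΨ'm.1, Ψ'.norm_eq, ENNReal.toReal_one] at h
    exact (pow_eq_one_iff_of_nonneg (norm_nonneg _) two_ne_zero).1 h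
  have hA2 : ‖hAm.toLp _‖ ^ 2 = (occupation (n + 1) (constantMode L) Ψ.ψ).toReal := by
    rw [dv_norm_toLp_sq, dv_integral_norm_sq_eq_toReal hAm.1, ← dv_occupation_eq]
  have hA'2 : ‖hA'm.toLp _‖ ^ 2 = (occupation (n + 1) (constantMode L) Ψ'.ψ).toReal := by
    rw [dv_norm_toLp_sq, dv_integral_norm_sq_eq_toReal hA'm.1, ← dv_occupation_eq]
  have hTψ' : ⟪hTm.toLp _, hΨ'm.toLp _⟫_ℂ = ⟪hAm.toLp _, hA'm.toLp _⟫_ℂ := by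
    rw [dv_inner_toLp, dv_inner_toLp]
    exact dv_adjoint Ψ Ψ'
  have hTψ : ⟪hTm.toLp _, hΨm.toLp _⟫_ℂ = ⟪hAm.toLp _, hAm.toLp _⟫_ℂ := by
    rw [dv_inner_toLp, dv_inner_toLp]
    exact dv_adjoint Ψ Ψ
  have hTn : ‖hTm.toLp _‖ ^ 2 ≤ ‖hAm.toLp _‖ ^ 2 * ‖hAm.toLp _‖ ^ 2 + V := by
    rw [dv_norm_toLp_sq, dv_integral_norm_sq_eq_toReal hTae, hA2]
    have h := ENNReal.toReal_mono hfin hvar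
    rw [ENNReal.toReal_add (ENNReal.pow_ne_top ho_top) ENNReal.ofReal_ne_top, ENNReal.toReal_pow,
      ENNReal.toReal_ofReal hV, sq] at h
    exact h
  have hd : ‖hΨ'm.toLp Ψ'.ψ - c • hΨm.toLp Ψ.ψ‖ ^ 2 ≤ η ^ 2 := by
    have heq : hΨ'm.toLp Ψ'.ψ - c • hΨm.toLp Ψ.ψ =
        (hΨ'm.sub (hΨm.const_smul c)).toLp (Ψ'.ψ - c • Ψ.ψ) := by
      rw [MemLp.toLp_sub hΨ'm (hΨm.const_smul c), MemLp.toLp_const_smul]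
    rw [heq, dv_norm_toLp_sq]
    simpa only [Pi.sub_apply, Pi.smul_apply, smul_eq_mul] using hdist
  -- the core estimate, in reals
  have hmain := dv_abstract _ _ _ _ _ c hV hη hψ1 hψ'1 hTψ' hTψ hTn hd
  rw [hA2, hA'2] at hmain
  have hmN : (occupation (n + 1) (constantMode L) Ψ.ψ).toReal ≤ ((n + 1 : ℕ) : ℝ) := by
    have h := ENNReal.toReal_mono (ENNReal.natCast_ne_top _) hoN
    rwa [ENNReal.toReal_natCast] at h
  have hm0 : 0 ≤ (occupation (n + 1) (constantMode L) Ψ.ψ).toReal := ENNReal.toReal_nonneg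
  have hm'0 : 0 ≤ (occupation (n + 1) (constantMode L) Ψ'.ψ).toReal := ENNReal.toReal_nonneg
  have hmη := mul_le_mul_of_nonneg_right hmN (sq_nonneg η)
  have hK : 0 ≤ ((n + 1 : ℕ) : ℝ) * η ^ 2 + 2 * Real.sqrt V * η := by positivity
  -- back to `ℝ≥0∞`
  rw [← ENNReal.ofReal_toReal ho_top, ← ENNReal.ofReal_toReal ho_top', ← ENNReal.ofReal_natCast,
    ← ENNReal.ofReal_sub _ hm'0, ← ENNReal.ofReal_sub _ hm0, ← ENNReal.ofReal_add (by linarith) hK]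
  refine ENNReal.ofReal_le_ofReal ?_
  nlinarith [hmain, hmη]

end Summit.AtomisticToContinuum.BoseEinsteinCondensation.Cruxes.NudgeRemoval.Registered

end
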